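import Mathlib
import HarnessLib
import Summits.ABC.ABC.Statement
import Summits.ABC.ABC.Theorems.SoloBlindLinearPencilMatveev
import Summits.ABC.ABC.Theorems.SoloBlindLinearPencilRidout

/-!
# The linear pencils `x^l + b = 2^n`, `2^l + b = x^n` are decided by Ridout × Matveev (abc there, ineffectively in `l`)

`Summits/ABC/ABC/Theorems/SoloBlindLinearPencils.lean`; namespace `Summit.ABC.ABC.Theorems`
(solo seat `solo-ABC-blind`, wall coordinate T55, part 3 of 3: assembly of `SoloBlindLinearPencilMatveev` (trivial
regimes, large `l`, `l ∣ n`) and `SoloBlindLinearPencilRidout` (fixed `(l, n mod l)`); companion of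
`SoloBlindSquarePencilRidout` (T53, the square pencil) and of the `ω = 3` files `SoloBlindOmega3Prelude` /
`SoloBlindShapeAKnown`).

Fix an odd `x ≥ 1` and exponents `l, n` with `x^l ≠ 2^n`, and put `b = |2^n − x^l| ≥ 1`, `M = max(2^n, x^l)`.
**Theorem** (`linearPencil_of_padicRoth_matveev`): granting (i) the `p`-adic Thue–Siegel–Roth theorem for rationals
(Ridout 1958 [Ridout1958]; Bombieri–Gubler, *Heights*, Thm. 6.2.3 with `K = ℚ`, `S ∋ ∞` [BombieriGubler2006]) in
exactly the shape `hRat` already used by `SoloBlindSquarePencilRidout` and `Literature/…/PadicRothIntegers`, and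
(ii) Matveev's bound for linear forms in two logarithms (the tree's named fact `matveev2000_linearFormsLog_rat`
[Matveev2000]), for every `ε > 0` there is `C = C(ε) > 0` with
`M < C · (x · b)^{1+ε}`   for all odd `x` and all `l, n` with `x^l ≠ 2^n`.
Since `rad(x^l · b · 2^n) ≥ 2·x·b` whenever `x`, `b` are squarefree (then `b` is odd and coprime to `x`), this is
abc on the two LINEAR PENCILS of the `ω = 3` landscape — `p^l + q = 2^n` and `2^l + q = r^n`, `p, q, r` prime —
with an ineffective constant (`linearPencilB_abc`, `linearPencilA_abc`, `omega3_linearPencilB_abc`,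
`omega3_linearPencilA_abc`).  READING for the wall: the difficulty of these pencils is exactly "an EFFECTIVE Ridout
theorem for the finitely many numbers `2^{s/l}`, `0 < s < l < L₀(ε)`, against `2`-power numerators", nothing more;
the large-`l` half is explicit (Matveev), the `l ∣ n` half elementary.

Assembly: `C(ε) = (2^{1+ε} + 1) + Σ_{l < L₀(ε)} Σ_{s < l} C(l, s, ε) + 3` (the inner constants chosen by `choose`
from `linearPencil_ridout`, `1` where `s = 0`).

## Main statements

* `linearPencil_of_padicRoth_matveev` — the theorem above.
* `linearPencilB_two_mul_le_rad`, `linearPencilA_two_mul_le_rad` — `2xb ≤ rad` on the two pencils.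
* `linearPencilB_abc` — `hRat →` Matveev `→` abc for `x^l + b = 2^n` (`l ≥ 1`; `x` odd; `x`, `b` squarefree).
* `linearPencilA_abc` — the same for `2^l + b = x^n` (`l ≥ 1`).
* `omega3_linearPencilB_abc`, `omega3_linearPencilA_abc` — the prime pencils `p^l + q = 2^n` (`p ≠ 2`) and
  `2^l + q = r^n` (`r ≠ 2`).
* `linearPencilB_isABCTriple` — for the record, these are abc triples.

Trust base: `hRat` (Ridout) and the Matveev named fact, as hypotheses where they occur; everything else is proved.
[this project]

## References

* [Ridout1958] D. Ridout, *The p-adic generalization of the Thue–Siegel–Roth theorem*, Mathematika 5 (1958) 40–48.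
* [BombieriGubler2006] E. Bombieri, W. Gubler, *Heights in Diophantine Geometry*, CUP 2006, Thm. 6.2.3.
* [Matveev2000] E. M. Matveev, *An explicit lower bound for a homogeneous rational linear form in logarithms of
  algebraic numbers. II*, Izv. Math. 64 (2000) 1217–1269 (Evertse–Győry 2015, Thm. 3.2.4).
-/

noncomputable section

namespace Summit.ABC.ABC.Theorems

open Real UniqueFactorizationMonoid Literature.NumberTheory.DiophantineApproximation
  Literature.NumberTheory.DiophantineGeometry Literature.NumberTheory.DiophantineGeometry.Dioph

/-! ## Assembly -/

/-- **The linear pencils are decided by Ridout × Matveev.**  Granting `hRat` (Ridout 1958 / Bombieri–Gubler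
Thm. 6.2.3 over `ℚ`) and `matveev2000_linearFormsLog_rat`: for every `ε > 0` there is `C > 0` such that for all
odd `x` and all `l, n` with `x^l ≠ 2^n`,
`max(2^n, x^l) < C · (x · |2^n − x^l|)^{1+ε}`. [this project] -/
theorem linearPencil_of_padicRoth_matveev
    (hRat : ∀ (S : Finset Nat.Primes) (α₀ : ℝ), IsAlgebraic ℚ α₀ →
      ∀ (α : ∀ p : Nat.Primes, @PadicAlgCl (p : ℕ) ⟨p.2⟩), (∀ p ∈ S, IsAlgebraic ℚ (α p)) →
      ∀ κ : ℝ, 2 < κ →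
        {β : ℚ | min 1 |(β : ℝ) - α₀| *
            (∏ p ∈ S, min (1 : ℝ) ‖(β : @PadicAlgCl (p : ℕ) ⟨p.2⟩) - α p‖) ≤
          (max (|(β.num : ℝ)|) (β.den : ℝ)) ^ (-κ)}.Finite)
    (hM : matveev2000_linearFormsLog_rat) :
    ∀ ε : ℝ, 0 < ε → ∃ C : ℝ, 0 < C ∧ ∀ x l n : ℕ, Odd x → x ^ l ≠ 2 ^ n →
      max ((2 : ℝ) ^ n) ((x : ℝ) ^ l) < C * ((x : ℝ) * |(2 : ℝ) ^ n - (x : ℝ) ^ l|) ^ (1 + ε) := by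
  intro ε hε
  obtain ⟨L₀, hlarge⟩ := linearPencil_large hM hε
  have hsmall : ∀ l s : ℕ, ∃ C : ℝ, 0 < C ∧ (0 < s → s < l → ∀ x t : ℕ, Odd x →
      max ((2 : ℝ) ^ (l * t + s)) ((x : ℝ) ^ l) <
        C * ((x : ℝ) * |(2 : ℝ) ^ (l * t + s) - (x : ℝ) ^ l|) ^ (1 + ε)) := by
    intro l s
    by_cases h : 0 < s ∧ s < l
    · obtain ⟨C, hC0, hC⟩ := linearPencil_ridout hRat h.1 h.2 hε
      exact ⟨C, hC0, fun _ _ => hC⟩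
    · exact ⟨1, one_pos, fun hs hsl => absurd ⟨hs, hsl⟩ h⟩
  choose Cf hCf0 hCf using hsmall
  set CR : ℝ := ∑ l ∈ Finset.range L₀, ∑ s ∈ Finset.range l, Cf l s with hCR
  have hCR0 : 0 ≤ CR :=
    Finset.sum_nonneg fun l _ => Finset.sum_nonneg fun s _ => (hCf0 l s).le
  have hCM0 : (0 : ℝ) < (2 : ℝ) ^ (1 + ε) + 1 := by positivity
  refine ⟨((2 : ℝ) ^ (1 + ε) + 1) + CR + 3, by linarith, ?_⟩
  intro x l n hxodd hne
  have hYnn : (0 : ℝ) ≤ ((x : ℝ) * |(2 : ℝ) ^ n - (x : ℝ) ^ l|) ^ (1 + ε) :=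
    Real.rpow_nonneg (mul_nonneg (by positivity) (abs_nonneg _)) _
  have hfin : ∀ {A : ℝ}, A ≤ ((2 : ℝ) ^ (1 + ε) + 1) + CR + 3 →
      max ((2 : ℝ) ^ n) ((x : ℝ) ^ l) < A * ((x : ℝ) * |(2 : ℝ) ^ n - (x : ℝ) ^ l|) ^ (1 + ε) →
      max ((2 : ℝ) ^ n) ((x : ℝ) ^ l) <
        (((2 : ℝ) ^ (1 + ε) + 1) + CR + 3) * ((x : ℝ) * |(2 : ℝ) ^ n - (x : ℝ) ^ l|) ^ (1 + ε) :=
    fun hA h => lt_of_lt_of_le h (mul_le_mul_of_nonneg_right hA hYnn)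
  by_cases hl : L₀ ≤ l
  · exact hfin (by linarith) (hlarge x l n hxodd hl hne)
  push Not at hl
  rcases Nat.eq_zero_or_pos l with hl0 | hlpos
  · -- `l = 0`: `1 ≠ 2^n`, so `n ≥ 1` and `2 · 1 ≤ 2^n` (trivial regime)
    subst hl0
    have hn : n ≠ 0 := by rintro rfl; exact hne (by simp)
    exact hfin (by linarith) (linearPencil_trivial hε (by norm_num : (2 : ℝ) < 3) hxodd.pos hne
      (Or.inl (by rw [pow_zero, mul_one]; exact Nat.one_lt_two_pow hn)))
  · have hn : n = l * (n / l) + n % l := (Nat.div_add_mod n l).symm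
    rcases Nat.eq_zero_or_pos (n % l) with hs0 | hspos
    · -- `l ∣ n`
      have hn' : n = l * (n / l) := by omega
      have h1 := linearPencil_divisible (t := n / l) hε hxodd hlpos (by rw [← hn']; exact hne)
      rw [← hn'] at h1
      exact hfin (by linarith) h1
    · -- `0 < s < l`
      have hsl : n % l < l := Nat.mod_lt n hlpos
      have h1 := hCf l (n % l) hspos hsl x (n / l) hxodd
      rw [← hn] at h1
      have hle : Cf l (n % l) ≤ CR := by
        have h2 : Cf l (n % l) ≤ ∑ s ∈ Finset.range l, Cf l s :=
          Finset.single_le_sum (f := fun s => Cf l s) (fun s _ => (hCf0 l s).le)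
            (Finset.mem_range.mpr hsl)
        have h3 : ∑ s ∈ Finset.range l, Cf l s ≤ CR :=
          Finset.single_le_sum (f := fun l' => ∑ s ∈ Finset.range l', Cf l' s)
            (fun l' _ => Finset.sum_nonneg fun s _ => (hCf0 l' s).le) (Finset.mem_range.mpr hl)
        exact h2.trans h3
      exact hfin (by linarith) h1

/-! ## abc on the two linear pencils -/

/-- On `x^l + b = 2^n` with `l ≥ 1`, `x` odd and `x`, `b` squarefree: `2·x·b ≤ rad(x^l · b · 2^n)`
(`2xb` is squarefree and divides `x^l b 2^n`). [folklore] -/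
theorem linearPencilB_two_mul_le_rad {x b l n : ℕ} (hl : 1 ≤ l) (hx : Odd x) (hsx : Squarefree x)
    (hsb : Squarefree b) (he : x ^ l + b = 2 ^ n) : 2 * (x * b) ≤ rad (x ^ l) b (2 ^ n) := by
  have hb0 : b ≠ 0 := hsb.ne_zero
  have hxl : Odd (x ^ l) := hx.pow
  have hn : n ≠ 0 := by
    rintro rfl
    have : 1 ≤ x ^ l := Nat.one_le_pow _ _ hx.pos
    rw [pow_zero] at he
    omega
  have h2n : Even (2 ^ n) := (Nat.even_pow' hn).mpr even_two
  have hbodd : Odd b := by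
    rcases Nat.even_or_odd b with hb | hb
    · exfalso
      have : Odd (2 ^ n) := by rw [← he]; exact hxl.add_even hb
      exact (Nat.not_even_iff_odd.mpr this) h2n
    · exact hb
  have hcop : Nat.Coprime x b := by
    have h1 : Nat.Coprime x (x * x ^ (l - 1) + b) := by
      rw [← pow_succ', Nat.sub_add_cancel hl, he]
      exact (Nat.coprime_two_right.mpr hx).pow_right n
    exact (Nat.coprime_mul_left_add_right x b (x ^ (l - 1))).mp h1
  have hsf : Squarefree (2 * x * b) := by
    rw [Nat.squarefree_mul_iff, Nat.squarefree_mul_iff]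
    exact ⟨Nat.Coprime.mul_left (Nat.coprime_two_left.mpr hbodd) hcop,
      ⟨Nat.coprime_two_left.mpr hx, Nat.squarefree_two, hsx⟩, hsb⟩
  have hne : x ^ l * b * 2 ^ n ≠ 0 :=
    mul_ne_zero (mul_ne_zero (pow_ne_zero _ hx.pos.ne') hb0) (pow_ne_zero _ two_ne_zero)
  have hdvd : 2 * x * b ∣ rad (x ^ l) b (2 ^ n) := by
    rw [rad_def, dvd_radical_iff hsf.isRadical hne]
    refine ⟨x ^ (l - 1) * 2 ^ (n - 1), ?_⟩
    rw [show x ^ l = x * x ^ (l - 1) by rw [← pow_succ', Nat.sub_add_cancel hl],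
      show 2 ^ n = 2 * 2 ^ (n - 1) by rw [← pow_succ', Nat.sub_add_cancel (Nat.one_le_iff_ne_zero.mpr hn)]]
    ring
  have h := Nat.le_of_dvd (by rw [rad_def]; exact Nat.radical_pos _) hdvd
  calc 2 * (x * b) = 2 * x * b := by ring
    _ ≤ _ := h

/-- On `2^l + b = x^n` with `l ≥ 1`, `x` odd and `x`, `b` squarefree: `2·x·b ≤ rad(2^l · b · x^n)`. [folklore] -/
theorem linearPencilA_two_mul_le_rad {x b l n : ℕ} (hl : 1 ≤ l) (hx : Odd x) (hsx : Squarefree x)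
    (hsb : Squarefree b) (he : 2 ^ l + b = x ^ n) : 2 * (x * b) ≤ rad (2 ^ l) b (x ^ n) := by
  have hb0 : b ≠ 0 := hsb.ne_zero
  have hxn : Odd (x ^ n) := hx.pow
  have h2l : Even (2 ^ l) := (Nat.even_pow' (by omega)).mpr even_two
  have hn : n ≠ 0 := by
    rintro rfl
    have : 2 ≤ 2 ^ l := Nat.one_lt_two_pow (by omega)
    rw [pow_zero] at he
    omega
  have hbodd : Odd b := by
    rcases Nat.even_or_odd b with hb | hb
    · exfalso
      have : Even (x ^ n) := by rw [← he]; exact h2l.add hb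
      exact (Nat.not_even_iff_odd.mpr hxn) this
    · exact hb
  have hcop : Nat.Coprime b x := by
    have h1 : Nat.Coprime b (x ^ n) := by
      rw [← he, show 2 ^ l + b = 1 * b + 2 ^ l by ring]
      exact (Nat.coprime_mul_right_add_right b (2 ^ l) 1).mpr
        ((Nat.coprime_two_right.mpr hbodd).pow_right l)
    exact (Nat.coprime_pow_right_iff (Nat.pos_of_ne_zero hn) _ _).mp h1
  have hsf : Squarefree (2 * b * x) := by
    rw [Nat.squarefree_mul_iff, Nat.squarefree_mul_iff]
    exact ⟨Nat.Coprime.mul_left (Nat.coprime_two_left.mpr hx) hcop,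
      ⟨Nat.coprime_two_left.mpr hbodd, Nat.squarefree_two, hsb⟩, hsx⟩
  have hne : 2 ^ l * b * x ^ n ≠ 0 :=
    mul_ne_zero (mul_ne_zero (pow_ne_zero _ two_ne_zero) hb0) (pow_ne_zero _ hx.pos.ne')
  have hdvd : 2 * b * x ∣ rad (2 ^ l) b (x ^ n) := by
    rw [rad_def, dvd_radical_iff hsf.isRadical hne]
    refine ⟨2 ^ (l - 1) * x ^ (n - 1), ?_⟩
    rw [show x ^ n = x * x ^ (n - 1) by rw [← pow_succ', Nat.sub_add_cancel (Nat.one_le_iff_ne_zero.mpr hn)],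
      show 2 ^ l = 2 * 2 ^ (l - 1) by rw [← pow_succ', Nat.sub_add_cancel hl]]
    ring
  have h := Nat.le_of_dvd (by rw [rad_def]; exact Nat.radical_pos _) hdvd
  calc 2 * (x * b) = 2 * b * x := by ring
    _ ≤ _ := h

/-- **abc on the linear pencil `x^l + b = 2^n` (shape B: `p^l + q = 2^n`), granting Ridout and Matveev.**
For every `ε > 0` there is `C > 0` with `c = 2^n < C · rad(x^l · b · 2^n)^{1+ε}` whenever `l ≥ 1`, `x` is odd
and `x`, `b` are squarefree.  Ineffective. [this project] -/
theorem linearPencilB_abc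
    (hRat : ∀ (S : Finset Nat.Primes) (α₀ : ℝ), IsAlgebraic ℚ α₀ →
      ∀ (α : ∀ p : Nat.Primes, @PadicAlgCl (p : ℕ) ⟨p.2⟩), (∀ p ∈ S, IsAlgebraic ℚ (α p)) →
      ∀ κ : ℝ, 2 < κ →
        {β : ℚ | min 1 |(β : ℝ) - α₀| *
            (∏ p ∈ S, min (1 : ℝ) ‖(β : @PadicAlgCl (p : ℕ) ⟨p.2⟩) - α p‖) ≤
          (max (|(β.num : ℝ)|) (β.den : ℝ)) ^ (-κ)}.Finite)
    (hM : matveev2000_linearFormsLog_rat) :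
    ∀ ε : ℝ, 0 < ε → ∃ C : ℝ, 0 < C ∧ ∀ x b l n : ℕ, 1 ≤ l → Odd x → Squarefree x → Squarefree b →
      x ^ l + b = 2 ^ n → ((2 ^ n : ℕ) : ℝ) < C * ((rad (x ^ l) b (2 ^ n) : ℕ) : ℝ) ^ (1 + ε) := by
  intro ε hε
  obtain ⟨C, hC0, hC⟩ := linearPencil_of_padicRoth_matveev hRat hM ε hε
  refine ⟨C, hC0, ?_⟩
  intro x b l n hl hx hsx hsb he
  have hb0 : b ≠ 0 := hsb.ne_zero
  have hne : x ^ l ≠ 2 ^ n := by intro h; apply hb0; omega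
  have h1 := hC x l n hx hne
  have heR : (x : ℝ) ^ l + b = (2 : ℝ) ^ n := by exact_mod_cast he
  have hbR : |(2 : ℝ) ^ n - (x : ℝ) ^ l| = b := by
    rw [show (2 : ℝ) ^ n - (x : ℝ) ^ l = b by linarith]
    exact abs_of_nonneg (by positivity)
  rw [hbR] at h1
  have hX0 : (0 : ℝ) < x := by exact_mod_cast hx.pos
  have hB0 : (0 : ℝ) < b := by exact_mod_cast Nat.pos_of_ne_zero hb0
  have hrad : (x : ℝ) * b ≤ ((rad (x ^ l) b (2 ^ n) : ℕ) : ℝ) := by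
    have h2 : ((2 * (x * b) : ℕ) : ℝ) ≤ ((rad (x ^ l) b (2 ^ n) : ℕ) : ℝ) := by
      exact_mod_cast linearPencilB_two_mul_le_rad hl hx hsx hsb he
    push_cast at h2
    nlinarith [mul_pos hX0 hB0]
  have hmono : ((x : ℝ) * b) ^ (1 + ε) ≤ ((rad (x ^ l) b (2 ^ n) : ℕ) : ℝ) ^ (1 + ε) :=
    Real.rpow_le_rpow (by positivity) hrad (by linarith)
  calc ((2 ^ n : ℕ) : ℝ) = (2 : ℝ) ^ n := by push_cast; ring
    _ ≤ max ((2 : ℝ) ^ n) ((x : ℝ) ^ l) := le_max_left _ _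
    _ < C * ((x : ℝ) * b) ^ (1 + ε) := h1
    _ ≤ C * ((rad (x ^ l) b (2 ^ n) : ℕ) : ℝ) ^ (1 + ε) := mul_le_mul_of_nonneg_left hmono hC0.le

/-- **abc on the linear pencil `2^l + b = x^n` (shape A: `2^l + q = r^n`), granting Ridout and Matveev.**
For every `ε > 0` there is `C > 0` with `c = x^n < C · rad(2^l · b · x^n)^{1+ε}` whenever `l ≥ 1`, `x` is odd
and `x`, `b` are squarefree.  Ineffective. [this project] -/
theorem linearPencilA_abc
    (hRat : ∀ (S : Finset Nat.Primes) (α₀ : ℝ), IsAlgebraic ℚ α₀ →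
      ∀ (α : ∀ p : Nat.Primes, @PadicAlgCl (p : ℕ) ⟨p.2⟩), (∀ p ∈ S, IsAlgebraic ℚ (α p)) →
      ∀ κ : ℝ, 2 < κ →
        {β : ℚ | min 1 |(β : ℝ) - α₀| *
            (∏ p ∈ S, min (1 : ℝ) ‖(β : @PadicAlgCl (p : ℕ) ⟨p.2⟩) - α p‖) ≤
          (max (|(β.num : ℝ)|) (β.den : ℝ)) ^ (-κ)}.Finite)
    (hM : matveev2000_linearFormsLog_rat) :
    ∀ ε : ℝ, 0 < ε → ∃ C : ℝ, 0 < C ∧ ∀ x b l n : ℕ, 1 ≤ l → Odd x → Squarefree x → Squarefree b →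
      2 ^ l + b = x ^ n → ((x ^ n : ℕ) : ℝ) < C * ((rad (2 ^ l) b (x ^ n) : ℕ) : ℝ) ^ (1 + ε) := by
  intro ε hε
  obtain ⟨C, hC0, hC⟩ := linearPencil_of_padicRoth_matveev hRat hM ε hε
  refine ⟨C, hC0, ?_⟩
  intro x b l n hl hx hsx hsb he
  have hb0 : b ≠ 0 := hsb.ne_zero
  have hne : x ^ n ≠ 2 ^ l := by intro h; apply hb0; omega
  have h1 := hC x n l hx hne
  have heR : (2 : ℝ) ^ l + b = (x : ℝ) ^ n := by exact_mod_cast he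
  have hbR : |(2 : ℝ) ^ l - (x : ℝ) ^ n| = b := by
    rw [show (2 : ℝ) ^ l - (x : ℝ) ^ n = -(b : ℝ) by linarith, abs_neg]
    exact abs_of_nonneg (by positivity)
  rw [hbR] at h1
  have hX0 : (0 : ℝ) < x := by exact_mod_cast hx.pos
  have hB0 : (0 : ℝ) < b := by exact_mod_cast Nat.pos_of_ne_zero hb0
  have hrad : (x : ℝ) * b ≤ ((rad (2 ^ l) b (x ^ n) : ℕ) : ℝ) := by
    have h2 : ((2 * (x * b) : ℕ) : ℝ) ≤ ((rad (2 ^ l) b (x ^ n) : ℕ) : ℝ) := by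
      exact_mod_cast linearPencilA_two_mul_le_rad hl hx hsx hsb he
    push_cast at h2
    nlinarith [mul_pos hX0 hB0]
  have hmono : ((x : ℝ) * b) ^ (1 + ε) ≤ ((rad (2 ^ l) b (x ^ n) : ℕ) : ℝ) ^ (1 + ε) :=
    Real.rpow_le_rpow (by positivity) hrad (by linarith)
  calc ((x ^ n : ℕ) : ℝ) = (x : ℝ) ^ n := by push_cast; ring
    _ ≤ max ((2 : ℝ) ^ l) ((x : ℝ) ^ n) := le_max_right _ _
    _ < C * ((x : ℝ) * b) ^ (1 + ε) := h1
    _ ≤ C * ((rad (2 ^ l) b (x ^ n) : ℕ) : ℝ) ^ (1 + ε) := mul_le_mul_of_nonneg_left hmono hC0.le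

/-- **The `ω = 3` linear pencil `p^l + q = 2^n`** (`p, q` prime, `p ≠ 2`, `l ≥ 1`): abc holds there, granting
Ridout and Matveev (ineffectively). [this project] -/
theorem omega3_linearPencilB_abc
    (hRat : ∀ (S : Finset Nat.Primes) (α₀ : ℝ), IsAlgebraic ℚ α₀ →
      ∀ (α : ∀ p : Nat.Primes, @PadicAlgCl (p : ℕ) ⟨p.2⟩), (∀ p ∈ S, IsAlgebraic ℚ (α p)) →
      ∀ κ : ℝ, 2 < κ →
        {β : ℚ | min 1 |(β : ℝ) - α₀| *
            (∏ p ∈ S, min (1 : ℝ) ‖(β : @PadicAlgCl (p : ℕ) ⟨p.2⟩) - α p‖) ≤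
          (max (|(β.num : ℝ)|) (β.den : ℝ)) ^ (-κ)}.Finite)
    (hM : matveev2000_linearFormsLog_rat) :
    ∀ ε : ℝ, 0 < ε → ∃ C : ℝ, 0 < C ∧ ∀ p q l n : ℕ, p.Prime → q.Prime → p ≠ 2 → 1 ≤ l →
      p ^ l + q = 2 ^ n → ((2 ^ n : ℕ) : ℝ) < C * ((rad (p ^ l) q (2 ^ n) : ℕ) : ℝ) ^ (1 + ε) := by
  intro ε hε
  obtain ⟨C, hC0, hC⟩ := linearPencilB_abc hRat hM ε hε
  exact ⟨C, hC0, fun p q l n hp hq hp2 hl he =>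
    hC p q l n hl (hp.odd_of_ne_two hp2) hp.prime.squarefree hq.prime.squarefree he⟩

/-- **The `ω = 3` linear pencil `2^l + q = r^n`** (`q, r` prime, `r ≠ 2`, `l ≥ 1`): abc holds there, granting
Ridout and Matveev (ineffectively). [this project] -/
theorem omega3_linearPencilA_abc
    (hRat : ∀ (S : Finset Nat.Primes) (α₀ : ℝ), IsAlgebraic ℚ α₀ →
      ∀ (α : ∀ p : Nat.Primes, @PadicAlgCl (p : ℕ) ⟨p.2⟩), (∀ p ∈ S, IsAlgebraic ℚ (α p)) →
      ∀ κ : ℝ, 2 < κ →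
        {β : ℚ | min 1 |(β : ℝ) - α₀| *
            (∏ p ∈ S, min (1 : ℝ) ‖(β : @PadicAlgCl (p : ℕ) ⟨p.2⟩) - α p‖) ≤
          (max (|(β.num : ℝ)|) (β.den : ℝ)) ^ (-κ)}.Finite)
    (hM : matveev2000_linearFormsLog_rat) :
    ∀ ε : ℝ, 0 < ε → ∃ C : ℝ, 0 < C ∧ ∀ q r l n : ℕ, q.Prime → r.Prime → r ≠ 2 → 1 ≤ l →
      2 ^ l + q = r ^ n → ((r ^ n : ℕ) : ℝ) < C * ((rad (2 ^ l) q (r ^ n) : ℕ) : ℝ) ^ (1 + ε) := by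
  intro ε hε
  obtain ⟨C, hC0, hC⟩ := linearPencilA_abc hRat hM ε hε
  exact ⟨C, hC0, fun q r l n hq hr hr2 hl he =>
    hC r q l n hl (hr.odd_of_ne_two hr2) hr.prime.squarefree hq.prime.squarefree he⟩

/-- For the record: `(x^l, b, 2^n)` with `x` odd, `b ≥ 1` and `x^l + b = 2^n` is an abc triple. [folklore] -/
theorem linearPencilB_isABCTriple {x b l n : ℕ} (hx : Odd x) (hb : 0 < b)
    (he : x ^ l + b = 2 ^ n) : IsABCTriple (x ^ l) b (2 ^ n) := by
  refine ⟨pow_pos hx.pos _, hb, he, ?_⟩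
  have h1 : Nat.Coprime (x ^ l) (x ^ l + b) := by
    rw [he]
    exact (Nat.coprime_two_right.mpr hx.pow).pow_right n
  rwa [Nat.coprime_self_add_right] at h1

end Summit.ABC.ABC.Theorems
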